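import Summits.QuantumFields.YangMills.Theorems.UnitScaleTiltHalvingHSiteTopH42Datum
import Summits.QuantumFields.YangMills.Theorems.UnitScaleTiltHalvingP1FlatCoreTopH42Gamma
import Summits.QuantumFields.YangMills.Theorems.UnitScaleTiltHalvingHSiteTopRowsOfSocketsGamma
import Summits.QuantumFields.YangMills.Theorems.UnitScaleTiltHalvingHSiteTopReadsFull
import HarnessLib

/-!
# `hP1room` PROGRAMME — EDITION γ (LEAD-H WORD 25 «V7-8γ ruled: inner top class by the ε₁-route, collar top bonds DISPLAYED as `H42topCrossL`», ★w3-20520 g8's brick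
# ✓`P1FlatCoreTopH42Gamma.H42_top_guarded_γ`), FILE (γ-3c′) [v3.1, knit predicate on PRINT's top class]: ★★ THE `H42` TEXT OF T4γ ✓`siteSizeRows_of_topRows_γ` AT THE KNIT GAUGE, ON PRINT's SPLIT CLASS `cubeLamBP′`,
# FROM THE COMPOSER's ROWS + THE SUPPLIED INNER (top) ROW + THE DISPLAYED COLLAR RESIDUAL

Route `UnitScaleTilt`, crux K1 child «MinimiserStabilityRegPr» (stmt-QuantumFields-19200), registered stub `stub_halvingStep` (`BirthV10`).  Cell `ym3-torus` (HUMAN RULING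
D-0037: YM₃ on T³ is ladder rung R3 — NOT d = 4, NOT infinite volume, NOT a mass gap, NOT the Clay problem), width seat `ym-ust-19200-w3` gen 9 (twin of ★w7-19200 g5's
✓p668024 `H42_of_rows` ∘ ✓p666867 `H42_of_towerTop`, merged; the brick is ★w3-20520 g8's).  `--supports stmt-QuantumFields-19200 --as helper`; THEOREMS ONLY (0 `def`,
0 `sorry`); count-neutral; nothing here claims the displayed residual, the stub, the crux or the gap.

WHAT.  ★★ `H42_of_rows_γD` = ✓p680954 `H42_of_rows_γ` with the KNIT CLAUSE (inside `Lan`, both in the residual hypothesis `H42cross` and in the conclusion's Landau antecedent) ranging over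
the boxes of PRINT's top class `cubeLamBP′ … k k k` instead of the inner class (so the datum-closed residual of the v3.1 composers pins the exponent on the collar boxes —
ym-ust-20520-w5 g9 LOCATE-2 §2; the brick's `hLan` over `ΛbIn := cubeLamB …` is the restriction by ✓`cubeLamB_top_subset_cubeLamBP'`).  Otherwise: = ✓p668024 `H42_of_rows` (member geometry, J3's three rows, the datum `(u₁, W, A)`, the top step's `λ′` with its (1.108) sizes, the SUPPLIED inner top
row `htop` on `cubeLamB … k k k`, numeric windows) with these changes of letter: (i) [Balaban1985Averaging] Prop. 4's windows ONE LEVEL LOWER at `(L²ε₀, L·α₂)`, `α₂ := 2(L·c⋆) + 8α₄`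
(`hα3γ hα4γ h16Pγ hsmallPγ hc₃Pγ`, the brick's letters = HARVEST-v2γ ✓p679383's rows); (ii) ONE MORE HYPOTHESIS `H42cross` — [Balaban1985RegularSpaces] (1.42) at the knit
gauge on the level-`k` COLLAR bonds `cubeLamBP′ … k k k ∖ cubeLamB … k k k` of print's class, ∀(`u`, `V′`, `A′`)-closed under the conclusion's own antecedents (the composers
display its ∀`gJ`∕`g′` closure `H42topCrossL`; print's mechanism there is (1.29) at level `k − 1` on the collar territory — the «mixed-end top (1.42)» (M2), OPEN tonight;
A6: ✓`P1FlatCoreTopH42Gamma.hcross_trivial_datum`); (iii) CONCLUSION on print's split class: `∀ j ≤ K − n, ∀ c ∈ cubeLamBP′ … (K − n) (K − n) j, ‖Q_j(1, iηA′)(c)‖ < 2dLα₁`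
(T4γ's `H42` binder at the knit gauge; the knit clause inside its Landau antecedent stays on the inner class).  Proof: ✓p668024's `λ′`-size and (G5) reads steps VERBATIM, then
ONE `exact H42_top_guarded_γ …` over lit ✓`hΩ_cubeFam` ∕ ✓`cubeLamBP'_hbox_pred` ∕ ✓`cubeLamBP'_hclass` (levels `j < k`), ✓`h34_of_inAk_univ` ∕ ✓`hAx_of_inAx_one`,
✓(γ-2b) `h135_cubeMember_γ` ((1.35) under the γ box law off J3's tower row), `ΛbIn := cubeLamB … k k k`, `hIn := cubeLamB_top_subset_cubeLamBP'`.
HONEST SCOPE: by-name composition; the collar residual is DISPLAYED, not derived; nothing of Prop. 3∕4 or the stub is proved here.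

References: T. Bałaban, CMP **99** (1985) 75–102 [Balaban1985RegularSpaces] ((1.42) p.83, Prop. 3 p.87, (1.29) p.81, (1.31) p.82, (1.35) p.82, (1.108) p.94, (1.131) p.99);
CMP **96** (1984) 223–250 [Balaban1984PropagatorsII] ((2.3) p.224); CMP **98** (1985) 17–51 [Balaban1985Averaging] ((97)–(100) p.32, Prop. 4 pp.38–39);
CMP **102** (1985) 277–309 [Balaban1985Variational] ((152)–(156) pp.301–302).
-/

set_option autoImplicit false

noncomputable section

open scoped BigOperators Matrix.Norms.L2Operator
open NormedSpace
open Complex (I)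

namespace Summit.QuantumFields.YangMills.Theorems.HalvingHSiteTopH42OfRowsGammaD

open Literature.MathematicalPhysics.QuantumFieldTheory.Balaban1983to89
open T4Continuum
open Literature.MathematicalPhysics.QuantumFieldTheory.Balaban1983to89.T3ContinuumYM3Torus
open Literature.MathematicalPhysics.QuantumFieldTheory.Balaban1983to89.T3PrintedRegularMinimiser (regFibrePr)
open MatrixLog (mlog)
open B5Eq118OneStroke (iterBlockOf)
open B7Prop1Explicit renaming Site → LSite
open B7Prop1Explicit (e)
open B7Prop2Explicit (unitaryUnits C0 c2' avgIter)
open B7Prop2SpecialUnitary (mem_specialUnitaryUnits specialUnitaryUnits_le_unitaryUnits)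
open B7Prop3Flat (c3)
open B7Prop4Flat (C2 c4)
open B7Prop1Local (InBox loK bondHiK)
open B7Eq92Concrete (mgauge)
open B8Ineq130 (tlo thi)
open B8Ineq132 (InAk)
open B8Eq119TwistedAxial (Restr129 InAx)
open B8Eq131Cubes (cube gs tLo tHi)
open B8Eq131CubesAdmissible (cubeFam)
open B8CubeMemberZd (cubeLamS cubeLamB)
open B8Eq184Proof (gaugeExp cfgExp)
open B8Eq140Level (SideTouches)
open B8Ineq132 (covDerivFwd)
open B8LambdaSpaceKLevel (wt)
open B8Eq146AExpansion (iEta)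
open B8Eq138LandauZd (IsLandau138W)
open B7Prop4GeneralLevels (logCovIter)
open B10Eq27TorusAxialLog (rel pull unitsField toUField suIncl gaugeActT axialT)
open B15Eq112TorusCover (lift cover)
open Node00 (coverAt)
open Summit.QuantumFields.YangMills.Theorems.Prop8ChartDoubleBar (dbarIterU vframeU)
open Summit.QuantumFields.YangMills.Theorems (FlatMinimizerH.le_T3)
open HalvingHSiteTopH42Datum (ends_mem_cubeLamS_top)
open P1FlatCoreTopH42Gamma (H42_top_guarded_γ cubeLamB_top_subset_cubeLamBP')
open B8CubeMemberZd (hΩ_cubeFam)  open B9SupplySockB9P3ZdGamma (cubeLamBP')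
open B8CubeMemberLamBPrimeLaws (cubeLamBP'_hbox_pred cubeLamBP'_hclass)
open HalvingP1FlatCoreSupplierInduction (h34_of_inAk_univ hAx_of_inAx_one)
open HalvingHSiteTopRowsOfSocketsGamma (h135_cubeMember_γ)
open HalvingHSiteTopReadsFull (topReadsFull_of_datum)
open HalvingHSiteTorusBlocks (rep_mem_cube_top_of_mem)
open P1FlatCoreTopLinearKnit (tgt_mk_coverAt)

variable (F : T3Family) {n K : ℕ}

/-- ★★ **THE `H42` TEXT OF T4γ FROM THE COMPOSER's ROWS, THE INNER (top) ROW AND THE DISPLAYED COLLAR RESIDUAL (FILE (γ-3c))** — see the module docstring.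
[cite: Balaban1985RegularSpaces, (1.42) p.83, Prop. 3 p.87, (1.29) p.81, (1.31) p.82, (1.35) p.82, (1.108) p.94, (1.131) p.99; Balaban1984PropagatorsII, (2.3) p.224; Balaban1985Averaging, (97)-(100) p.32; Balaban1985Variational, (152)-(156) pp.301-302] -/
theorem H42_of_rows_γD (hd2 : 2 ≤ (F.P K).d) (hnK : n < K) (x₀ : Site (F.P K) 0) {a : LSite (F.P K).d} {M' ρ' : ℕ} (hρ' : (F.P K).L ≤ ρ')
    (ha : ∀ ν, a ν ≤ ((iterBlockOf (K - n) x₀ ν).val : ℤ) ∧ ((iterBlockOf (K - n) x₀ ν).val : ℤ) ≤ a ν + M' - 1)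
    (hroomW : 2 * ((F.P K).L ^ (K - n) * (M' + 1) + ρ' * gs (F.P K).L (K - n)) ≤ (F.P K).sitesPerDir 0)
    {ε₀ : ℝ} (hε₀ : 0 < ε₀) (U : GaugeField (F.P K) 0 (Matrix.specialUnitaryGroup (Fin 2) ℂ))
    -- J3's pre-gauge and its three rows
    (gJ : GaugeTransf (F.P K) 0 (Matrix.specialUnitaryGroup (Fin 2) ℂ)) {α₁ : ℝ}
    (hInAk : InAk (F.P K).L (K - n) (((F.L : ℝ)⁻¹) ^ (K - n)) ε₀ (fun _ => (Set.univ : Set (LSite (F.P K).d))) (pull (unitsField (toUField (GaugeField.gaugeAct gJ U))) 0))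
    (hInAx : ∀ m', m' ≤ K - n → ∀ Λ : ℕ → Set (LSite (F.P K).d),
      InAx (F.P K).L m' Λ (1 : LSite (F.P K).d → Fin (F.P K).d → (Matrix (Fin 2) (Fin 2) ℂ)ˣ) (pull (unitsField (toUField (GaugeField.gaugeAct gJ U))) 0))
    (htw : ∀ m', m' ≤ K - n → ∀ (x : LSite (F.P K).d) (ν : Fin (F.P K).d), tlo (F.P K).L (tLo a ρ') m' ≤ x → x + e ν ≤ thi (F.P K).L (tHi a M' ρ') m' →
      ‖((avgIter (F.P K).L (pull (unitsField (toUField (GaugeField.gaugeAct gJ U))) 0) (K - n - m') x ν : (Matrix (Fin 2) (Fin 2) ℂ)ˣ) :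
          Matrix (Fin 2) (Fin 2) ℂ) - 1‖ < α₁)
    -- Theorem 4's datum in the member's letters
    {u₁ : LSite (F.P K).d → (Matrix (Fin 2) (Fin 2) ℂ)ˣ} {W : LSite (F.P K).d → Fin (F.P K).d → (Matrix (Fin 2) (Fin 2) ℂ)ˣ}
    {A : LSite (F.P K).d → Fin (F.P K).d → Matrix (Fin 2) (Fin 2) ℂ}
    (hu₁ : ∀ x, u₁ x ∈ unitaryUnits (Matrix (Fin 2) (Fin 2) ℂ))
    (hW : mgauge (1 : LSite (F.P K).d → Fin (F.P K).d → (Matrix (Fin 2) (Fin 2) ℂ)ˣ) u₁ W = pull (unitsField (toUField (GaugeField.gaugeAct gJ U))) 0)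
    {c₁ : ℝ} (hchartTop : ∀ z ∈ cube (F.P K).L a M' ρ' (K - n) (K - n), ∀ ν : Fin (F.P K).d,
      W z ν = cfgExp (((F.L : ℝ)⁻¹) ^ (K - n)) A z ν ∧ ((F.L : ℝ)⁻¹) ^ (K - n) * ‖A z ν‖ ≤ c₁)
    -- the top step's `λ′`: Hermitian, and ✓`siteTopRows_of_sockets(_base)`' conjunct 4 («(1.108) sizes» on the sides touching every `Ω j`)
    {lam : LSite (F.P K).d → Matrix (Fin 2) (Fin 2) ℂ} {α₄ : ℝ} (hsa : ∀ x, IsSelfAdjoint (lam x))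
    (h108 : ∀ j, j ≤ K - n → ∀ b ∈ {b : LSite (F.P K).d × Fin (F.P K).d | SideTouches (cubeFam false (F.P K).L a M' ρ' (K - n) j) b.1 b.2},
      ‖lam b.1‖ ≤ α₄ ∧ wt (F.P K).L (((F.L : ℝ)⁻¹) ^ (K - n)) j *
        ‖covDerivFwd (((F.L : ℝ)⁻¹) ^ (K - n)) (1 : LSite (F.P K).d → Fin (F.P K).d → (Matrix (Fin 2) (Fin 2) ℂ)ˣ) b.2 lam b.1‖ ≤ α₄)
    -- the (top) row, SUPPLIED (the composer's displayed socket `HTOP` instantiated at its witnesses; the PACK closes it by ✓`htop_of_knitGauge`)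
    {t : ℝ} (htop : ∀ c ∈ (cubeLamB (F.P K).L a M' ρ' (K - n) (K - n)) (K - n),
      ‖mlog ((dbarIterU (K - n) (gaugeActT (fun s => ((u₁ * gaugeExp lam) (lift (F.P K) x₀ + rel x₀ s))⁻¹ * Unitary.toUnits (suIncl (gJ s)) :
          GaugeTransf (F.P K) 0 (Matrix (Fin 2) (Fin 2) ℂ)ˣ) (unitsField (toUField U)))
          ⟨coverAt (F.P K) (K - n) c.1, c.2⟩ : (Matrix (Fin 2) (Fin 2) ℂ)ˣ) : Matrix (Fin 2) (Fin 2) ℂ)‖ ≤ t)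
    -- the composer's Prop-3 windows (VERBATIM) and the knit ∕ read ∕ (1.42) windows (window hand)
    {cstar : ℝ} (hα₁ : 0 < α₁) (hα₂ : 0 ≤ 2 * ((F.P K).L * cstar) + 8 * α₄)
    -- EDITION γ: [3] Prop. 4's windows ONE LEVEL LOWER at `(L²ε₀, L·α₂)`, `α₂ := 2(L·c⋆) + 8α₄` (the brick's letters; HARVEST-v2γ ✓p679383's rows)
    (hα3γ : C0 (F.P K).d * (((F.P K).L : ℝ) ^ 2 * ε₀) ≤ 1 / 3) (hα4γ : 4 * (((F.P K).L : ℝ) ^ 2 * ε₀) ≤ c2' (F.P K).d (F.P K).L)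
    (h16Pγ : 16 * (((F.P K).L : ℝ) * (2 * ((F.P K).L * cstar) + 8 * α₄)) ≤ 1)
    (hsmallPγ : Real.exp (4 * (800 * (((F.P K).d : ℝ) + 1) ^ 2 * (((F.P K).d : ℝ) + 4)) * (((F.P K).L : ℝ) ^ 2 * ε₀))
      * (1 + 8 * (131072 * (((F.P K).d : ℝ) + 1) ^ 2) * (((F.P K).L : ℝ) * (2 * ((F.P K).L * cstar) + 8 * α₄))) ≤ 2)
    (hc₃Pγ : 2 * (((F.P K).L : ℝ) * (2 * ((F.P K).L * cstar) + 8 * α₄)) ≤ c3 (F.P K).d (F.P K).L) (hsmall₁ : ((F.P K).d : ℝ) * (F.P K).L * α₁ ≤ 1 / 8)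
    (hkb : 2 * ((F.P K).L * cstar) + 8 * α₄ ≤ c4 (F.P K).d)
    (hbudget : 243200 * ((((F.P K).d + 2) * (F.P K).L : ℕ) : ℝ) ^ 2 * (2 * ((F.P K).L * cstar) + 8 * α₄) ≤ 1)
    (hr : Real.exp (2 * α₄) * ((Real.exp c₁ - 1) + α₄ * (((F.P K).L : ℝ) ^ (K - n))⁻¹) ≤ 1 / 2)
    (hr2 : 2 * (Real.exp (2 * α₄) * ((Real.exp c₁ - 1) + α₄ * (((F.P K).L : ℝ) ^ (K - n))⁻¹)) ≤ (2 * ((F.P K).L * cstar) + 8 * α₄) * (((F.P K).L : ℝ) ^ (K - n))⁻¹)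
    (hwin : t + (C2 (F.P K).d + 64 * 60800 * ((((F.P K).d + 2) * (F.P K).L : ℕ) : ℝ) ^ 2) * (2 * ((F.P K).L * cstar) + 8 * α₄) ^ 2 <
      2 * ((F.P K).d : ℝ) * (F.P K).L * α₁)
    -- EDITION γ — THE DISPLAYED RESIDUAL: (1.42) at the knit gauge on the level-`k` COLLAR bonds of print's class, ∀(`u`, `V′`, `A′`)-closed (the brick's `H42cross`)
    (H42cross : ∀ (u : LSite (F.P K).d → (Matrix (Fin 2) (Fin 2) ℂ)ˣ) (V' : LSite (F.P K).d → Fin (F.P K).d → (Matrix (Fin 2) (Fin 2) ℂ)ˣ) (A' : LSite (F.P K).d → Fin (F.P K).d → (Matrix (Fin 2) (Fin 2) ℂ)),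
      (∀ x, u x ∈ unitaryUnits (Matrix (Fin 2) (Fin 2) ℂ)) → mgauge (1 : LSite (F.P K).d → Fin (F.P K).d → (Matrix (Fin 2) (Fin 2) ℂ)ˣ) u V' = (pull (unitsField (toUField (GaugeField.gaugeAct gJ U))) 0) →
      Restr129 (F.P K).L (K - n) (Function.update (cubeLamS (F.P K).L a M' ρ' (K - n) (K - n)) (K - n) ∅) (1 : LSite (F.P K).d → Fin (F.P K).d → (Matrix (Fin 2) (Fin 2) ℂ)ˣ) u →
      (IsLandau138W (F.P K).L (K - n) (((F.L : ℝ)⁻¹) ^ (K - n)) ((cubeFam false (F.P K).L a M' ρ' (K - n)) 0) (cubeLamS (F.P K).L a M' ρ' (K - n) (K - n)) (1 : LSite (F.P K).d → Fin (F.P K).d → (Matrix (Fin 2) (Fin 2) ℂ)ˣ) V' ∧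
        (∀ c ∈ (cubeLamBP' (F.P K).L a M' ρ' (K - n) (K - n)) (K - n), ∀ (y : LSite (F.P K).d) (τ : Fin (F.P K).d),
          InBox (loK (F.P K).L (K - n) c.1) (bondHiK (F.P K).L (K - n) c.1 c.2) y → InBox (loK (F.P K).L (K - n) c.1) (bondHiK (F.P K).L (K - n) c.1 c.2) (y + e τ) →
          V' y τ = gaugeActT (fun s => ((u₁ * gaugeExp lam) (lift (F.P K) x₀ + rel x₀ s))⁻¹ * Unitary.toUnits (suIncl (gJ s)) :
            GaugeTransf (F.P K) 0 (Matrix (Fin 2) (Fin 2) ℂ)ˣ) (unitsField (toUField U)) ⟨cover (F.P K) y, τ⟩)) →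
      (∀ y τ, IsSelfAdjoint (A' y τ)) →
      (∀ j, j ≤ K - n → ∀ y τ, SideTouches ((cubeFam false (F.P K).L a M' ρ' (K - n)) j) y τ →
        V' y τ = cfgExp (((F.L : ℝ)⁻¹) ^ (K - n)) A' y τ ∧ ‖A' y τ‖ ≤ (2 * ((F.P K).L * cstar) + 8 * α₄) * (((F.P K).L : ℝ) ^ j * (((F.L : ℝ)⁻¹) ^ (K - n)))⁻¹) →
      (∀ y τ, (∀ j, j ≤ K - n → ¬ SideTouches ((cubeFam false (F.P K).L a M' ρ' (K - n)) j) y τ) → A' y τ = 0) →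
      ∀ c ∈ (cubeLamBP' (F.P K).L a M' ρ' (K - n) (K - n)) (K - n), c ∉ (cubeLamB (F.P K).L a M' ρ' (K - n) (K - n)) (K - n) →
        ‖logCovIter (F.P K).L (1 : LSite (F.P K).d → Fin (F.P K).d → (Matrix (Fin 2) (Fin 2) ℂ)ˣ) (iEta (((F.L : ℝ)⁻¹) ^ (K - n)) A') (K - n) c.1 c.2‖ < 2 * (F.P K).d * (F.P K).L * α₁) :
    -- CONCLUSION: the `H42` argument of ✓`siteSizeRows_of_topRows` at the knit gauge (= the composers' `H42 gJ hInAk hInAx g′`)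
    ∀ (u : LSite (F.P K).d → (Matrix (Fin 2) (Fin 2) ℂ)ˣ) (V' : LSite (F.P K).d → Fin (F.P K).d → (Matrix (Fin 2) (Fin 2) ℂ)ˣ)
        (A' : LSite (F.P K).d → Fin (F.P K).d → (Matrix (Fin 2) (Fin 2) ℂ)),
      (∀ x, u x ∈ unitaryUnits (Matrix (Fin 2) (Fin 2) ℂ)) → mgauge (1 : LSite (F.P K).d → Fin (F.P K).d → (Matrix (Fin 2) (Fin 2) ℂ)ˣ) u V' = (pull (unitsField (toUField (GaugeField.gaugeAct gJ U))) 0) →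
      Restr129 (F.P K).L (K - n) (Function.update (cubeLamS (F.P K).L a M' ρ' (K - n) (K - n)) (K - n) ∅) (1 : LSite (F.P K).d → Fin (F.P K).d → (Matrix (Fin 2) (Fin 2) ℂ)ˣ) u →
      (IsLandau138W (F.P K).L (K - n) (((F.L : ℝ)⁻¹) ^ (K - n)) ((cubeFam false (F.P K).L a M' ρ' (K - n)) 0) (cubeLamS (F.P K).L a M' ρ' (K - n) (K - n)) (1 : LSite (F.P K).d → Fin (F.P K).d → (Matrix (Fin 2) (Fin 2) ℂ)ˣ) V' ∧
        (∀ c ∈ (cubeLamBP' (F.P K).L a M' ρ' (K - n) (K - n)) (K - n), ∀ (y : LSite (F.P K).d) (τ : Fin (F.P K).d),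
          InBox (loK (F.P K).L (K - n) c.1) (bondHiK (F.P K).L (K - n) c.1 c.2) y → InBox (loK (F.P K).L (K - n) c.1) (bondHiK (F.P K).L (K - n) c.1 c.2) (y + e τ) →
          V' y τ = gaugeActT (fun s => ((u₁ * gaugeExp lam) (lift (F.P K) x₀ + rel x₀ s))⁻¹ * Unitary.toUnits (suIncl (gJ s)) :
            GaugeTransf (F.P K) 0 (Matrix (Fin 2) (Fin 2) ℂ)ˣ) (unitsField (toUField U)) ⟨cover (F.P K) y, τ⟩)) →
      (∀ y τ, IsSelfAdjoint (A' y τ)) →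
      (∀ j, j ≤ K - n → ∀ y τ, SideTouches ((cubeFam false (F.P K).L a M' ρ' (K - n)) j) y τ →
        V' y τ = cfgExp (((F.L : ℝ)⁻¹) ^ (K - n)) A' y τ ∧ ‖A' y τ‖ ≤ (2 * ((F.P K).L * cstar) + 8 * α₄) * (((F.P K).L : ℝ) ^ j * (((F.L : ℝ)⁻¹) ^ (K - n)))⁻¹) →
      (∀ y τ, (∀ j, j ≤ K - n → ¬ SideTouches ((cubeFam false (F.P K).L a M' ρ' (K - n)) j) y τ) → A' y τ = 0) →
      ∀ j, j ≤ K - n → ∀ c ∈ (cubeLamBP' (F.P K).L a M' ρ' (K - n) (K - n)) j, ‖logCovIter (F.P K).L (1 : LSite (F.P K).d → Fin (F.P K).d → (Matrix (Fin 2) (Fin 2) ℂ)ˣ) (iEta (((F.L : ℝ)⁻¹) ^ (K - n)) A') j c.1 c.2‖ < 2 * (F.P K).d * (F.P K).L * α₁ := by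
  have hk : K - n ≤ (F.P K).m + (F.P K).K := FlatMinimizerH.le_T3 F n K
  have hL1 : 1 ≤ (F.P K).L := (F.P K).L_pos
  have hρ'1 : 1 ≤ ρ' := hL1.trans hρ'
  have hL0 : (0 : ℝ) < (F.L : ℝ) := by have := F.hL.2; exact_mod_cast (by omega : 0 < F.L)
  have hη : (0 : ℝ) < ((F.L : ℝ)⁻¹) ^ (K - n) := pow_pos (inv_pos.2 hL0) _
  have hLk : (0 : ℝ) < ((F.P K).L : ℝ) ^ (K - n) := pow_pos (by exact_mod_cast hL1) _
  -- every bond out of a point of `Ω j` is a side touching `Ω j` (`d ≥ 2`)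
  have hST : ∀ (S : Set (LSite (F.P K).d)) (z : LSite (F.P K).d), z ∈ S → ∀ ν : Fin (F.P K).d, SideTouches S z ν := by
    intro S z hz ν
    haveI : Nontrivial (Fin (F.P K).d) := Fin.nontrivial_iff_two_le.2 hd2
    obtain ⟨κ, hκ⟩ := exists_ne ν
    exact B8Eq140Level.sideTouches_of_bondTouches hκ (Or.inl hz)
  have hd0 : 0 < (F.P K).d := by omega
  -- `λ′ ≤ α₄` on `□₀` and its gradient `≤ α₄L^{−k}` on `□_k`, from the (1.108) sizes
  have hlam0 : ∀ z ∈ cube (F.P K).L a M' ρ' (K - n) 0, ‖lam z‖ ≤ α₄ := by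
    intro z hz
    have hz' : z ∈ cubeFam false (F.P K).L a M' ρ' (K - n) 0 := by rwa [B8Eq131CubesAdmissible.cubeFam_false_of_le _ _ _ _ (Nat.zero_le _)]
    exact (h108 0 (Nat.zero_le _) (z, ⟨0, hd0⟩) (hST _ z hz' _)).1
  have hgrad : ∀ z ∈ cube (F.P K).L a M' ρ' (K - n) (K - n), ∀ ν : Fin (F.P K).d, ‖lam (z + e ν) - lam z‖ ≤ α₄ * (((F.P K).L : ℝ) ^ (K - n))⁻¹ := by
    intro z hz ν
    have hz' : z ∈ cubeFam false (F.P K).L a M' ρ' (K - n) (K - n) := by rwa [B8Eq131CubesAdmissible.cubeFam_false_of_le _ _ _ _ le_rfl]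
    have h := (h108 (K - n) le_rfl (z, ν) (hST _ z hz' ν)).2
    simp only [wt, covDerivFwd, Pi.one_apply, B8Eq191FlatStencils.conjR_unitOne, norm_smul, norm_inv, Real.norm_of_nonneg hη.le] at h
    rw [le_mul_inv_iff₀ hLk, mul_comm]
    calc ((F.P K).L : ℝ) ^ (K - n) * ‖lam (z + e ν) - lam z‖
        = ((F.P K).L : ℝ) ^ (K - n) * ((F.L : ℝ)⁻¹) ^ (K - n) * ((((F.L : ℝ)⁻¹) ^ (K - n))⁻¹ * ‖lam (z + e ν) - lam z‖) := by
          field_simp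
      _ ≤ α₄ := h
  -- the reads row: (G5) at the member (both `k`-blocks of a top constraint bond are top labels ⇒ representative in `□_k`)
  have hreads : ∀ c ∈ (cubeLamB (F.P K).L a M' ρ' (K - n) (K - n)) (K - n), ∀ b : PBond (F.P K) 0,
      (iterBlockOf (K - n) b.src = (⟨coverAt (F.P K) (K - n) c.1, c.2⟩ : PBond (F.P K) (K - n)).src ∨
        iterBlockOf (K - n) b.src = (⟨coverAt (F.P K) (K - n) c.1, c.2⟩ : PBond (F.P K) (K - n)).tgt) →
      (iterBlockOf (K - n) b.tgt = (⟨coverAt (F.P K) (K - n) c.1, c.2⟩ : PBond (F.P K) (K - n)).src ∨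
        iterBlockOf (K - n) b.tgt = (⟨coverAt (F.P K) (K - n) c.1, c.2⟩ : PBond (F.P K) (K - n)).tgt) →
      ‖((gaugeActT (fun s => ((u₁ * gaugeExp lam) (lift (F.P K) x₀ + rel x₀ s))⁻¹ * Unitary.toUnits (suIncl (gJ s)) :
          GaugeTransf (F.P K) 0 (Matrix (Fin 2) (Fin 2) ℂ)ˣ) (unitsField (toUField U)) b : (Matrix (Fin 2) (Fin 2) ℂ)ˣ) : Matrix (Fin 2) (Fin 2) ℂ) - 1‖ ≤
        Real.exp (2 * α₄) * ((Real.exp c₁ - 1) + α₄ * (((F.P K).L : ℝ) ^ (K - n))⁻¹) := by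
    intro c hc b hbs _
    obtain ⟨hc1mem, hc2mem⟩ := ends_mem_cubeLamS_top hL1 a M' ρ' (K - n) hc
    have hT : iterBlockOf (K - n) b.src ∈ {B : Site (F.P K) (K - n) | ∃ yc ∈ cubeLamS (F.P K).L a M' ρ' (K - n) (K - n) (K - n), B = coverAt (F.P K) (K - n) yc} := by
      rcases hbs with h | h
      · exact ⟨c.1, hc1mem, h⟩
      · exact ⟨c.1 + e c.2, hc2mem, h.trans (tgt_mk_coverAt _ _ _)⟩
    exact topReadsFull_of_datum hnK x₀ hρ'1 ha hroomW U gJ hu₁ hW hη.le hchartTop hsa hlam0 hgrad b (rep_mem_cube_top_of_mem hk x₀ ha hroomW hT)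
  -- the member geometry in edition γ (lit ✓`B8CubeMemberZd.hΩ_cubeFam`, ✓`B8CubeMemberLamBPrimeLaws`), J3's currency, (1.35) under the γ box law (✓(γ-2b))
  letI : CStarAlgebra (Matrix (Fin 2) (Fin 2) ℂ) := {}
  have hL2 : 2 ≤ (F.P K).L := by have := F.hL.2; exact this
  have hk1 : 1 ≤ K - n := by omega
  have hΩ := hΩ_cubeFam (d := (F.P K).d) hL1 a M' hρ' (K - n)
  have hboxP := cubeLamBP'_hbox_pred (d := (F.P K).d) hL1 a M' hρ' (K - n) (K - n) le_rfl
  have hclassP := cubeLamBP'_hclass (d := (F.P K).d) hL1 a M' hρ' (K - n) (K - n) le_rfl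
  have h34 := h34_of_inAk_univ hInAk (cubeFam false (F.P K).L a M' ρ' (K - n))
  have hAx := hAx_of_inAx_one hInAx (fun _ => Function.update (cubeLamS (F.P K).L a M' ρ' (K - n) (K - n)) (K - n) ∅) (K - n) le_rfl
  have h135c := h135_cubeMember_γ (P := F.P K) (𝔸 := (Matrix (Fin 2) (Fin 2) ℂ)) hL2 a M' hρ'1 htw
  have h135 : ∀ j, j ≤ K - n → ∀ (z : LSite (F.P K).d) (μ : Fin (F.P K).d),
      (∀ x, InBox (loK (F.P K).L j z) (bondHiK (F.P K).L j z μ) x → x ∈ cubeFam false (F.P K).L a M' ρ' (K - n) (j - 1)) →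
      ‖((avgIter (F.P K).L (B8Lemma1NonAbelian.mulCfg (pull (unitsField (toUField (GaugeField.gaugeAct gJ U))) 0) (1 : LSite (F.P K).d → Fin (F.P K).d → (Matrix (Fin 2) (Fin 2) ℂ)ˣ)) j z μ : (Matrix (Fin 2) (Fin 2) ℂ)ˣ) : (Matrix (Fin 2) (Fin 2) ℂ)) - 1‖ ≤ α₁ := by
    intro j hj z μ hb
    have h := h135c j hj z μ hb
    rwa [B8Ineq132.avgIter_one, Pi.one_apply, Pi.one_apply, Units.val_one] at h
  -- THE CALL (★w3-20520 g8's brick, BY NAME)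
  exact H42_top_guarded_γ (n := Fin 2) hd2 hL2 hk1 hk hη hε₀ hα₁ hα₂ hα3γ hα4γ h16Pγ hsmallPγ hc₃Pγ hsmall₁
    (cubeFam false (F.P K).L a M' ρ' (K - n)) hΩ (cubeLamS (F.P K).L a M' ρ' (K - n) (K - n)) (cubeLamBP' (F.P K).L a M' ρ' (K - n) (K - n))
    hboxP (fun j hj => hclassP j hj.le) h34 hAx h135
    (fun _ V' => (IsLandau138W (F.P K).L (K - n) (((F.L : ℝ)⁻¹) ^ (K - n)) ((cubeFam false (F.P K).L a M' ρ' (K - n)) 0) (cubeLamS (F.P K).L a M' ρ' (K - n) (K - n)) (1 : LSite (F.P K).d → Fin (F.P K).d → (Matrix (Fin 2) (Fin 2) ℂ)ˣ) V' ∧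
        (∀ c ∈ (cubeLamBP' (F.P K).L a M' ρ' (K - n) (K - n)) (K - n), ∀ (y : LSite (F.P K).d) (τ : Fin (F.P K).d),
          InBox (loK (F.P K).L (K - n) c.1) (bondHiK (F.P K).L (K - n) c.1 c.2) y → InBox (loK (F.P K).L (K - n) c.1) (bondHiK (F.P K).L (K - n) c.1 c.2) (y + e τ) →
          V' y τ = gaugeActT (fun s => ((u₁ * gaugeExp lam) (lift (F.P K) x₀ + rel x₀ s))⁻¹ * Unitary.toUnits (suIncl (gJ s)) :
            GaugeTransf (F.P K) 0 (Matrix (Fin 2) (Fin 2) ℂ)ˣ) (unitsField (toUField U)) ⟨cover (F.P K) y, τ⟩)))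
    (gaugeActT (fun s => ((u₁ * gaugeExp lam) (lift (F.P K) x₀ + rel x₀ s))⁻¹ * Unitary.toUnits (suIncl (gJ s)) : GaugeTransf (F.P K) 0 (Matrix (Fin 2) (Fin 2) ℂ)ˣ) (unitsField (toUField U)))
    ((cubeLamB (F.P K).L a M' ρ' (K - n) (K - n)) (K - n)) (cubeLamB_top_subset_cubeLamBP' hL1 a M' ρ' hk1)
    (fun W h c hc => h.2 c (cubeLamB_top_subset_cubeLamBP' hL1 a M' ρ' hk1 hc)) hr hr2 hreads hkb hbudget htop hwin H42cross

end Summit.QuantumFields.YangMills.Theorems.HalvingHSiteTopH42OfRowsGammaD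

end
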